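import Summits.CriticalPhenomena.PercolationContinuityZ3.Theorems.Transplant.FKConnectivityAllQFastEvalBridge
import Summits.CriticalPhenomena.PercolationContinuityZ3.Theorems.Transplant.FKConnectivityAllQForestAdjacentSliceNoSq
import Literature.Probability.Percolation.KozmaNitzanSeparatingTriple
import HarnessLib

/-!
# KERNEL REFUTATION of the square-free q-graded two-cluster Rayleigh node R_q⁰:
# `¬ TwoClusterRayleighGradedNoSqOn (Fin 9)` and `¬ TwoClusterRayleighGradedNoSqPos`

Support file (`--supports stmt-CriticalPhenomena-4575`), FK sub-lane `prim-bschramm-fk-1` (gen 19) of the post-continuity programme;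
builds on p205010 (kernel theorem, internal audit signed; external expert review pending).  One listed graph (definition) and a few
computable Boolean / `ℕ` evaluators on masks (definitions), no named facts, no sorries; standard axioms (`decide +kernel` on the verified
fast evaluator of `…FastEval*.lean`, as in `…ForestSquareCex.lean`; no `native_decide`).

THE NODE.  `TwoClusterRayleighGradedNoSqOn V` (fk-1 g16/g17, `…TwoClusterRayleighNoSq.lean`, the LIVE HEAD of the lineage's map after
gen 17: R_q⁰ ⟹ CW-OSNC ⟹ OSNC ⟹ EDOM ⟹ CA₂ ⟹ FP2 and R_q⁰ ⟹ (♣)⁰): for every fibre `(M, u₀)`, all `a c u v x y` with `a ~ u`,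
`c ~ x` in `u₀`, and every level `s`,
`Σ_{i+j=s} #(ω ∪ {e,f} ∈ {a↮c} ∩ L_i, ω ∆ M ∈ {a↮c} ∩ L_j) ≤ Σ_{i+j=s} #(ω ∪ {e} ∈ {a↮c} ∩ L_i, (ω ∆ M) ∪ {f} ∈ {a↮c} ∩ L_j)`
(`e = uv`, `f = xy`, `L_i` = exactly `i` open clusters) — "FK-OSNC coefficientwise in `(x, y, q)`".

THE WITNESS (gen 19; found by an adversarial annealing search over the reduced instances `u₀ = ∅`, `a = u`, `c = x`, memo
bschramm/FROM-fk-1-g19-*.md §3, re-verified by two independent implementations).  `H` on `{0,…,8}`,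
`E(H) = M = {06, 07, 14, 15, 18, 26, 27, 34, 35, 47, 56}` (11 pairs), `a = u = 0`, `c = x = 1`, `v = 2`, `y = 3`, so `e = 02`, `f = 13`
(neither in `M`), fibre `(M, ∅)`, level `s = 6`.  The level-6 graded counts are `LHS = 83 + 147 + 64 = 294` (cells `(i,j) = (2,4), (3,3),
(4,2)`) and `RHS = 72 + 144 + 72 = 288`, so `294 ≤ 288` fails.  (The forest slice `s = 5` of the same instance holds, `60 ≤ 64`: the
square-free adjacent forest Rayleigh node `AdjForestRayleighNoSqPos` is NOT touched; neither is `CwOsncFibrePos`, the `(2,2)` cell, which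
is empty here.)  Structure: two diamonds `{0,2}×{6,7}` and `{1,3}×{4,5}` joined by `47, 56`, a pendant `18` at `c`; `e` and `f` join twins.

THE CERTIFICATE.  `gradedCount_collapse` (`…ForestAdjacentSlice.lean`) turns each graded count into ONE fibre count with the summed
level in the first event; `fibreCount_conf_eq_card_bool` (`…FastEvalBridge.lean`) turns a fibre count on `(conf (firstT 11), ∅)` into a
count of masks `a < 2¹¹` satisfying a Boolean; the Booleans `gL`, `gR` below read the two events through `joinedB_iff` (open
reachability), `kOf_eq_clusterCount` (cluster count), `KNSep.reachable_insert_iff` and `Wheel.clusterCount_insert_free` (one inserted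
pair); two pairs of `decide +kernel` evaluations give `LHS = 294`, `RHS = 288`.
[cite: Grimmett2006, §1.4 eq. (1.20) (p. 15); §3.9 eq. (3.94) (p. 63)] [cite: Linusson2011, Prop. 2.6]
-/

namespace Summit.CriticalPhenomena.PercolationContinuityZ3.Theorems

namespace FK

open Set Literature.Probability.LatticeModels Literature.Probability.Percolation
open scoped symmDiff Classical

/-- **The witness graph** `H + e + f` on `Fin 9`: listed pairs `0..10 = E(H) = M`, `11 = e = (0,2)`, `12 = f = (1,3)`; parameters unused
(`0`), `q = 1`. (fk-1 g19's counterexample to R_q⁰) -/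
abbrev cexD9 : RCEval where
  n := 9
  m := 13
  src := ![0, 0, 1, 1, 1, 2, 2, 3, 3, 4, 5, 0, 1]
  dst := ![6, 7, 4, 5, 8, 6, 7, 4, 5, 7, 6, 2, 3]
  c := fun _ => 0
  q := 1

namespace GradedNoSqCex

open RCEval

/-! ### The data -/

/-- The data is valid (pairs distinct). [folklore] -/
theorem valid : cexD9.Valid := by decide +kernel

/-- Listed pair `11` is `e = s(0,2)`. [folklore] -/
theorem edge_eleven : cexD9.edge 11 = s((0 : Fin 9), 2) := by decide +kernel

/-- Listed pair `12` is `f = s(1,3)`. [folklore] -/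
theorem edge_twelve : cexD9.edge 12 = s((1 : Fin 9), 3) := by decide +kernel

/-- The fibre: `M = E(H)`, the configuration of the first 11 listed pairs. [folklore] -/
def M : BondConfig (Fin 9) := cexD9.conf (cexD9.firstT 11)

/-- `e, f ∉` any sub-configuration of the first 11 pairs. [folklore] -/
theorem e_f_notMem {t : Finset (Fin 13)} (ht : t ⊆ cexD9.firstT 11) :
    s((0 : Fin 9), 2) ∉ cexD9.conf t ∧ s((1 : Fin 9), 3) ∉ cexD9.conf t := by
  rw [← edge_eleven, ← edge_twelve, edge_mem_conf valid, edge_mem_conf valid]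
  constructor
  · intro h; have := (mem_firstT 11 _).1 (ht h); simp at this
  · intro h; have := (mem_firstT 11 _).1 (ht h); simp at this

/-- The complementary mask within `M`. [folklore] -/
def cpl (a : ℕ) : ℕ := Nat.xor 2047 a

/-- The complementary mask is the `xor` with `2¹¹ − 1` and opens only the first 11 pairs. [folklore] -/
theorem cpl_eq (a : ℕ) (ha : a < 2 ^ 11) : Nat.xor (2 ^ 11 - 1) a = cpl a ∧ cexD9.tOf (cpl a) ⊆ cexD9.firstT 11 := by
  have h1 : Nat.xor (2 ^ 11 - 1) a = cpl a := by norm_num [cpl]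
  refine ⟨h1, ?_⟩
  rw [← h1, tOf_xor 11 a ha]
  exact Finset.sdiff_subset

/-- On the fibre `(M, ∅)` the partner of the mask configuration `a` is the configuration of the complementary mask. [folklore] -/
theorem symmDiff_M_eq (a : ℕ) (ha : a < 2 ^ 11) : cexD9.conf (cexD9.tOf a) ∆ M = cexD9.conf (cexD9.tOf (cpl a)) := by
  unfold M
  rw [symmDiff_eq_sdiff_of_subset (conf_mono (tOf_subset_firstT ha)), ← conf_sdiff valid, ← tOf_xor 11 a ha, (cpl_eq a ha).1]

/-! ### Boolean atoms: open reachability among `0,1,2,3` -/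

/-- `u ~ w` in the configuration of the mask `b` (computable). [folklore] -/
def rr (u w b : ℕ) : Bool := joinedB (cexD9.compsOf b) u w

section Reading

variable (b : ℕ)

/-- `rr` reads open reachability (mask configuration). [cite: Grimmett2006, §1.2 eq. (1.1) (p. 4)] -/
theorem rr_iff (u w : Fin 9) : rr u.val w.val b = true ↔ (openGraph (cexD9.conf (cexD9.tOf b))).Reachable u w :=
  joinedB_iff (D := cexD9) b u w

/-- `rr 0 1` reads `0 ~ 1`. [cite: Grimmett2006, §1.2 eq. (1.1) (p. 4)] -/
theorem t01 : rr 0 1 b = true ↔ (openGraph (cexD9.conf (cexD9.tOf b))).Reachable 0 1 := rr_iff b 0 1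
/-- `rr 0 2` reads `0 ~ 2`. [cite: Grimmett2006, §1.2 eq. (1.1) (p. 4)] -/
theorem t02 : rr 0 2 b = true ↔ (openGraph (cexD9.conf (cexD9.tOf b))).Reachable 0 2 := rr_iff b 0 2
/-- `rr 0 3` reads `0 ~ 3`. [cite: Grimmett2006, §1.2 eq. (1.1) (p. 4)] -/
theorem t03 : rr 0 3 b = true ↔ (openGraph (cexD9.conf (cexD9.tOf b))).Reachable 0 3 := rr_iff b 0 3
/-- `rr 1 2` reads `1 ~ 2`. [cite: Grimmett2006, §1.2 eq. (1.1) (p. 4)] -/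
theorem t12 : rr 1 2 b = true ↔ (openGraph (cexD9.conf (cexD9.tOf b))).Reachable 1 2 := rr_iff b 1 2
/-- `rr 1 3` reads `1 ~ 3`. [cite: Grimmett2006, §1.2 eq. (1.1) (p. 4)] -/
theorem t13 : rr 1 3 b = true ↔ (openGraph (cexD9.conf (cexD9.tOf b))).Reachable 1 3 := rr_iff b 1 3
/-- `rr 2 3` reads `2 ~ 3`. [cite: Grimmett2006, §1.2 eq. (1.1) (p. 4)] -/
theorem t23 : rr 2 3 b = true ↔ (openGraph (cexD9.conf (cexD9.tOf b))).Reachable 2 3 := rr_iff b 2 3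
/-- `rr 0 1 = false` reads `0 ≁ 1`. [cite: Grimmett2006, §1.2 eq. (1.1) (p. 4)] -/
theorem f01 : rr 0 1 b = false ↔ ¬ (openGraph (cexD9.conf (cexD9.tOf b))).Reachable 0 1 := by rw [← Bool.not_eq_true, t01]
/-- `rr 0 2 = false` reads `0 ≁ 2`. [cite: Grimmett2006, §1.2 eq. (1.1) (p. 4)] -/
theorem f02 : rr 0 2 b = false ↔ ¬ (openGraph (cexD9.conf (cexD9.tOf b))).Reachable 0 2 := by rw [← Bool.not_eq_true, t02]
/-- `rr 0 3 = false` reads `0 ≁ 3`. [cite: Grimmett2006, §1.2 eq. (1.1) (p. 4)] -/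
theorem f03 : rr 0 3 b = false ↔ ¬ (openGraph (cexD9.conf (cexD9.tOf b))).Reachable 0 3 := by rw [← Bool.not_eq_true, t03]
/-- `rr 1 2 = false` reads `1 ≁ 2`. [cite: Grimmett2006, §1.2 eq. (1.1) (p. 4)] -/
theorem f12 : rr 1 2 b = false ↔ ¬ (openGraph (cexD9.conf (cexD9.tOf b))).Reachable 1 2 := by rw [← Bool.not_eq_true, t12]
/-- `rr 1 3 = false` reads `1 ≁ 3`. [cite: Grimmett2006, §1.2 eq. (1.1) (p. 4)] -/
theorem f13 : rr 1 3 b = false ↔ ¬ (openGraph (cexD9.conf (cexD9.tOf b))).Reachable 1 3 := by rw [← Bool.not_eq_true, t13]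
/-- `rr 2 3 = false` reads `2 ≁ 3`. [cite: Grimmett2006, §1.2 eq. (1.1) (p. 4)] -/
theorem f23 : rr 2 3 b = false ↔ ¬ (openGraph (cexD9.conf (cexD9.tOf b))).Reachable 2 3 := by rw [← Bool.not_eq_true, t23]

/-- Orientation and reflexivity normalisers for open reachability (any configuration). [folklore] -/
theorem n10 (ω : BondConfig (Fin 9)) : (openGraph ω).Reachable 1 0 ↔ (openGraph ω).Reachable 0 1 := SimpleGraph.reachable_comm
/-- Orientation normaliser `2 ~ 0 ↔ 0 ~ 2`. [folklore] -/
theorem n20 (ω : BondConfig (Fin 9)) : (openGraph ω).Reachable 2 0 ↔ (openGraph ω).Reachable 0 2 := SimpleGraph.reachable_comm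
/-- Orientation normaliser `3 ~ 0 ↔ 0 ~ 3`. [folklore] -/
theorem n30 (ω : BondConfig (Fin 9)) : (openGraph ω).Reachable 3 0 ↔ (openGraph ω).Reachable 0 3 := SimpleGraph.reachable_comm
/-- Orientation normaliser `2 ~ 1 ↔ 1 ~ 2`. [folklore] -/
theorem n21 (ω : BondConfig (Fin 9)) : (openGraph ω).Reachable 2 1 ↔ (openGraph ω).Reachable 1 2 := SimpleGraph.reachable_comm
/-- Orientation normaliser `3 ~ 1 ↔ 1 ~ 3`. [folklore] -/
theorem n31 (ω : BondConfig (Fin 9)) : (openGraph ω).Reachable 3 1 ↔ (openGraph ω).Reachable 1 3 := SimpleGraph.reachable_comm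
/-- Orientation normaliser `3 ~ 2 ↔ 2 ~ 3`. [folklore] -/
theorem n32 (ω : BondConfig (Fin 9)) : (openGraph ω).Reachable 3 2 ↔ (openGraph ω).Reachable 2 3 := SimpleGraph.reachable_comm
/-- Reflexivity normaliser `x ~ x ↔ True`. [folklore] -/
theorem nrefl (ω : BondConfig (Fin 9)) (x : Fin 9) : (openGraph ω).Reachable x x ↔ True := iff_true_intro (SimpleGraph.Reachable.refl _)

/-- The configuration of a mask is the coerced finset of its listed pairs. [folklore] -/
theorem conf_eq_coe : cexD9.conf (cexD9.tOf b) = (↑((cexD9.tOf b).image cexD9.edge) : BondConfig (Fin 9)) := rfl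

/-- `kOf` reads the cluster count. [cite: Grimmett2006, §1.2 eq. (1.1) (p. 4)] -/
theorem cc_eq : clusterCount (cexD9.conf (cexD9.tOf b)) ∅ = cexD9.kOf b := (kOf_eq_clusterCount (D := cexD9) b).symm

end Reading

/-! ### Cluster counts after inserting `e`, `f`, or both (computable) -/

/-- `k(ω ∪ {e})` of the mask `b`. [cite: Grimmett2006, §1.2 eq. (1.1) (p. 4)] -/
def kE (b : ℕ) : ℕ := cexD9.kOf b - (bif rr 0 2 b then 0 else 1)

/-- `k(ω ∪ {f})` of the mask `b`. [cite: Grimmett2006, §1.2 eq. (1.1) (p. 4)] -/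
def kF (b : ℕ) : ℕ := cexD9.kOf b - (bif rr 1 3 b then 0 else 1)

/-- `1 ~ 3` in `ω ∪ {e}` of the mask `b`. [folklore] -/
def j13E (b : ℕ) : Bool := rr 1 3 b || (rr 0 1 b && rr 2 3 b) || (rr 1 2 b && rr 0 3 b)

/-- `k(ω ∪ {e, f})` of the mask `b`. [cite: Grimmett2006, §1.2 eq. (1.1) (p. 4)] -/
def kEF (b : ℕ) : ℕ := kE b - (bif j13E b then 0 else 1)

/-- **`k(ω ∪ {e}) = kE`.** [cite: Grimmett2006, §1.2 eq. (1.1) (p. 4)] -/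
theorem ccE_eq (b : ℕ) : clusterCount (insert s((0 : Fin 9), 2) (cexD9.conf (cexD9.tOf b))) ∅ = kE b := by
  have h := Wheel.clusterCount_insert_free ((cexD9.tOf b).image cexD9.edge) (0 : Fin 9) 2
  rw [Finset.coe_insert] at h
  change clusterCount (insert s((0 : Fin 9), 2) (cexD9.conf (cexD9.tOf b))) ∅ +
      (if (openGraph (cexD9.conf (cexD9.tOf b))).Reachable 0 2 then 0 else 1) = clusterCount (cexD9.conf (cexD9.tOf b)) ∅ at h
  rw [cc_eq] at h
  unfold kE
  by_cases hr : (openGraph (cexD9.conf (cexD9.tOf b))).Reachable 0 2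
  · rw [if_pos hr] at h; rw [(t02 b).2 hr, cond_true]; omega
  · rw [if_neg hr] at h; rw [(f02 b).2 hr, cond_false]; omega

/-- **`k(ω ∪ {f}) = kF`.** [cite: Grimmett2006, §1.2 eq. (1.1) (p. 4)] -/
theorem ccF_eq (b : ℕ) : clusterCount (insert s((1 : Fin 9), 3) (cexD9.conf (cexD9.tOf b))) ∅ = kF b := by
  have h := Wheel.clusterCount_insert_free ((cexD9.tOf b).image cexD9.edge) (1 : Fin 9) 3
  rw [Finset.coe_insert] at h
  change clusterCount (insert s((1 : Fin 9), 3) (cexD9.conf (cexD9.tOf b))) ∅ +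
      (if (openGraph (cexD9.conf (cexD9.tOf b))).Reachable 1 3 then 0 else 1) = clusterCount (cexD9.conf (cexD9.tOf b)) ∅ at h
  rw [cc_eq] at h
  unfold kF
  by_cases hr : (openGraph (cexD9.conf (cexD9.tOf b))).Reachable 1 3
  · rw [if_pos hr] at h; rw [(t13 b).2 hr, cond_true]; omega
  · rw [if_neg hr] at h; rw [(f13 b).2 hr, cond_false]; omega

/-- `j13E` reads `1 ~ 3` in `ω ∪ {e}`. [folklore] -/
theorem j13E_iff (b : ℕ) : (openGraph (insert s((0 : Fin 9), 2) (cexD9.conf (cexD9.tOf b)))).Reachable 1 3 ↔ j13E b = true := by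
  rw [KNSep.reachable_insert_iff]
  simp only [j13E, Bool.or_eq_true, Bool.and_eq_true, t13, t01, t23, t12, t03, n10]
  tauto

/-- **`k(ω ∪ {e, f}) = kEF`.** [cite: Grimmett2006, §1.2 eq. (1.1) (p. 4)] -/
theorem ccEF_eq (b : ℕ) : clusterCount (insert s((1 : Fin 9), 3) (insert s((0 : Fin 9), 2) (cexD9.conf (cexD9.tOf b)))) ∅ = kEF b := by
  have h := Wheel.clusterCount_insert_free (insert s((0 : Fin 9), 2) ((cexD9.tOf b).image cexD9.edge)) (1 : Fin 9) 3
  rw [Finset.coe_insert, Finset.coe_insert] at h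
  change clusterCount (insert s((1 : Fin 9), 3) (insert s((0 : Fin 9), 2) (cexD9.conf (cexD9.tOf b)))) ∅ +
      (if (openGraph (insert s((0 : Fin 9), 2) (cexD9.conf (cexD9.tOf b)))).Reachable 1 3 then 0 else 1) =
      clusterCount (insert s((0 : Fin 9), 2) (cexD9.conf (cexD9.tOf b))) ∅ at h
  rw [ccE_eq] at h
  unfold kEF
  by_cases hr : (openGraph (insert s((0 : Fin 9), 2) (cexD9.conf (cexD9.tOf b)))).Reachable 1 3
  · rw [if_pos hr] at h; rw [(j13E_iff b).1 hr, cond_true]; omega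
  · rw [if_neg hr] at h
    have hf : j13E b = false := by
      cases h' : j13E b
      · rfl
      · exact absurd ((j13E_iff b).2 h') hr
    rw [hf, cond_false]; omega

/-! ### The two Booleans of a mask (left and right graded counts at level 6) -/

/-- Left Boolean: `ω ∪ {e,f} ∈ {0↮1}`, `ω' ∈ {0↮1}`, `k(ω ∪ {e,f}) + k(ω') = 6` (`ω'` = complement in `M`). [cite: Linusson2011, Prop. 2.6] -/
def gL (a : ℕ) : Bool :=
  (!(rr 0 1 a) && !(rr 1 2 a) && !(rr 0 3 a) && !(rr 2 3 a)) && !(rr 0 1 (cpl a)) && (kEF a + cexD9.kOf (cpl a) == 6)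

/-- Right Boolean: `ω ∪ {e} ∈ {0↮1}`, `ω' ∪ {f} ∈ {0↮1}`, `k(ω ∪ {e}) + k(ω' ∪ {f}) = 6`. [cite: Linusson2011, Prop. 2.6] -/
def gR (a : ℕ) : Bool :=
  (!(rr 0 1 a) && !(rr 1 2 a)) && (!(rr 0 1 (cpl a)) && !(rr 0 3 (cpl a))) && (kE a + kF (cpl a) == 6)

/-- Indicator summands. [folklore] -/
def FL (a : ℕ) : ℕ := cond (gL a) 1 0
/-- Indicator summands. [folklore] -/
def FR (a : ℕ) : ℕ := cond (gR a) 1 0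

/-! ### The kernel evaluations -/

/-- First half of the left count. (this file's `decide +kernel` evaluation) -/
theorem sumR_FL_0 : sumR FL 10 0 = 182 := by decide +kernel
/-- Second half of the left count. (this file's `decide +kernel` evaluation) -/
theorem sumR_FL_1 : sumR FL 10 1024 = 112 := by decide +kernel
/-- First half of the right count. (this file's `decide +kernel` evaluation) -/
theorem sumR_FR_0 : sumR FR 10 0 = 144 := by decide +kernel
/-- Second half of the right count. (this file's `decide +kernel` evaluation) -/
theorem sumR_FR_1 : sumR FR 10 1024 = 144 := by decide +kernel

/-- **`Σ_{a<2¹¹} [gL a] = 294`.** (this file's `decide +kernel` evaluation) -/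
theorem sumR_FL : sumR FL 11 0 = 294 := by
  rw [sumR_split FL (d := 10) (by norm_num) (by norm_num : (1024 : ℕ) = 0 + 2 ^ 10), sumR_FL_0, sumR_FL_1]

/-- **`Σ_{a<2¹¹} [gR a] = 288`.** (this file's `decide +kernel` evaluation) -/
theorem sumR_FR : sumR FR 11 0 = 288 := by
  rw [sumR_split FR (d := 10) (by norm_num) (by norm_num : (1024 : ℕ) = 0 + 2 ^ 10), sumR_FR_0, sumR_FR_1]

/-! ### Reading the Booleans -/

/-- The left Boolean reads the collapsed left event pair. [cite: Linusson2011, Prop. 2.6] -/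
theorem gL_iff (a : ℕ) (ha : a < 2 ^ 11) :
    (cexD9.conf (cexD9.tOf a) ∈
        (({ω : BondConfig (Fin 9) | s((0 : Fin 9), 2) ∉ ω ∧ s((1 : Fin 9), 3) ∉ ω} ∩
            {ω | insert s((1 : Fin 9), 3) (insert s((0 : Fin 9), 2) ω) ∈ sepEv (0 : Fin 9) 1}) ∩
          {ω | clusterCount (insert s((1 : Fin 9), 3) (insert s((0 : Fin 9), 2) ω)) ∅ + clusterCount (ω ∆ M) ∅ = 6}) ∧
      cexD9.conf (cexD9.tOf (Nat.xor (2 ^ 11 - 1) a)) ∈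
        ({ω : BondConfig (Fin 9) | s((0 : Fin 9), 2) ∉ ω ∧ s((1 : Fin 9), 3) ∉ ω} ∩ sepEv (0 : Fin 9) 1)) ↔
      gL a = true := by
  obtain ⟨hc, hB⟩ := cpl_eq a ha
  rw [hc]
  obtain ⟨heA, hfA⟩ := e_f_notMem (tOf_subset_firstT (D := cexD9) ha)
  obtain ⟨heB, hfB⟩ := e_f_notMem hB
  simp only [mem_inter_iff, mem_setOf_eq, mem_sepEv_iff]
  rw [symmDiff_M_eq a ha, ccEF_eq, cc_eq]
  simp only [KNSep.reachable_insert_iff, gL, Bool.and_eq_true, Bool.not_eq_true', beq_iff_eq,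
    f01, f03, f12, f23, n10, n30, n21, n31, n32, nrefl, true_and, and_true, heA, hfA, heB, hfB, not_false_eq_true]
  tauto

/-- The right Boolean reads the collapsed right event pair. [cite: Linusson2011, Prop. 2.6] -/
theorem gR_iff (a : ℕ) (ha : a < 2 ^ 11) :
    (cexD9.conf (cexD9.tOf a) ∈
        (({ω : BondConfig (Fin 9) | s((0 : Fin 9), 2) ∉ ω ∧ s((1 : Fin 9), 3) ∉ ω} ∩
            {ω | insert s((0 : Fin 9), 2) ω ∈ sepEv (0 : Fin 9) 1}) ∩
          {ω | clusterCount (insert s((0 : Fin 9), 2) ω) ∅ + clusterCount (insert s((1 : Fin 9), 3) (ω ∆ M)) ∅ = 6}) ∧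
      cexD9.conf (cexD9.tOf (Nat.xor (2 ^ 11 - 1) a)) ∈
        ({ω : BondConfig (Fin 9) | s((0 : Fin 9), 2) ∉ ω ∧ s((1 : Fin 9), 3) ∉ ω} ∩
          {ω | insert s((1 : Fin 9), 3) ω ∈ sepEv (0 : Fin 9) 1})) ↔
      gR a = true := by
  obtain ⟨hc, hB⟩ := cpl_eq a ha
  rw [hc]
  obtain ⟨heA, hfA⟩ := e_f_notMem (tOf_subset_firstT (D := cexD9) ha)
  obtain ⟨heB, hfB⟩ := e_f_notMem hB
  simp only [mem_inter_iff, mem_setOf_eq, mem_sepEv_iff]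
  rw [symmDiff_M_eq a ha, ccE_eq, ccF_eq]
  simp only [KNSep.reachable_insert_iff, gR, Bool.and_eq_true, Bool.not_eq_true', beq_iff_eq,
    f01, f03, f12, n21, n31, nrefl, true_and, and_true, heA, hfA, heB, hfB, not_false_eq_true]
  tauto

/-! ### The two collapsed fibre counts -/

/-- **Left graded count at level 6 = 294.** [cite: Linusson2011, Prop. 2.6] -/
theorem left_eq :
    fibreCount M ∅
        (({ω : BondConfig (Fin 9) | s((0 : Fin 9), 2) ∉ ω ∧ s((1 : Fin 9), 3) ∉ ω} ∩
            {ω | insert s((1 : Fin 9), 3) (insert s((0 : Fin 9), 2) ω) ∈ sepEv (0 : Fin 9) 1}) ∩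
          {ω | clusterCount (insert s((1 : Fin 9), 3) (insert s((0 : Fin 9), 2) ω)) ∅ + clusterCount (ω ∆ M) ∅ = 6})
        ({ω : BondConfig (Fin 9) | s((0 : Fin 9), 2) ∉ ω ∧ s((1 : Fin 9), 3) ∉ ω} ∩ sepEv (0 : Fin 9) 1) = 294 := by
  have h11 : (11 : ℕ) ≤ cexD9.m := by decide
  unfold M
  rw [fibreCount_conf_eq_card_bool valid h11 gL (fun a ha => by have := gL_iff a ha; unfold M at this; exact this),
    card_filter_range_eq_sumR]
  have : (fun a => if gL a = true then 1 else 0) = FL := by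
    funext a; unfold FL; cases gL a <;> rfl
  rw [this, sumR_FL]

/-- **Right graded count at level 6 = 288.** [cite: Linusson2011, Prop. 2.6] -/
theorem right_eq :
    fibreCount M ∅
        (({ω : BondConfig (Fin 9) | s((0 : Fin 9), 2) ∉ ω ∧ s((1 : Fin 9), 3) ∉ ω} ∩
            {ω | insert s((0 : Fin 9), 2) ω ∈ sepEv (0 : Fin 9) 1}) ∩
          {ω | clusterCount (insert s((0 : Fin 9), 2) ω) ∅ + clusterCount (insert s((1 : Fin 9), 3) (ω ∆ M)) ∅ = 6})
        ({ω : BondConfig (Fin 9) | s((0 : Fin 9), 2) ∉ ω ∧ s((1 : Fin 9), 3) ∉ ω} ∩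
          {ω | insert s((1 : Fin 9), 3) ω ∈ sepEv (0 : Fin 9) 1}) = 288 := by
  have h11 : (11 : ℕ) ≤ cexD9.m := by decide
  unfold M
  rw [fibreCount_conf_eq_card_bool valid h11 gR (fun a ha => by have := gR_iff a ha; unfold M at this; exact this),
    card_filter_range_eq_sumR]
  have : (fun a => if gR a = true then 1 else 0) = FR := by
    funext a; unfold FR; cases gR a <;> rfl
  rw [this, sumR_FR]

/-! ### The refutation -/

/-- **`¬ TwoClusterRayleighGradedNoSqOn (Fin 9)`**: R_q⁰ fails at the fibre `(M, ∅)` of the witness graph, `a = u = 0`, `c = x = 1`,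
`v = 2`, `y = 3`, level `s = 6`: `294 ≤ 288` is false. [cite: Grimmett2006, §3.9 eq. (3.94) (p. 63)] [cite: Linusson2011, Prop. 2.6] -/
theorem not_twoClusterRayleighGradedNoSqOn_fin_nine : ¬ TwoClusterRayleighGradedNoSqOn (Fin 9) := by
  intro h
  have I := h M ∅ disjoint_bot_left (0 : Fin 9) 1 0 2 1 3 6 (SimpleGraph.Reachable.refl _) (SimpleGraph.Reachable.refl _)
  rw [gradedCount_collapse M ∅
      (A' := {ω : BondConfig (Fin 9) | s((0 : Fin 9), 2) ∉ ω ∧ s((1 : Fin 9), 3) ∉ ω} ∩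
        {ω | insert s((1 : Fin 9), 3) (insert s((0 : Fin 9), 2) ω) ∈ sepEv (0 : Fin 9) 1})
      (B' := {ω : BondConfig (Fin 9) | s((0 : Fin 9), 2) ∉ ω ∧ s((1 : Fin 9), 3) ∉ ω} ∩ sepEv (0 : Fin 9) 1)
      (κ₁ := fun ω => clusterCount (insert s((1 : Fin 9), 3) (insert s((0 : Fin 9), 2) ω)) ∅) (κ₂ := fun ω => clusterCount ω ∅)
      (fun i ω => by simp only [mem_inter_iff, mem_setOf_eq, mem_levelSet_iff, and_assoc])
      (fun j ω => by simp only [mem_inter_iff, mem_setOf_eq, mem_levelSet_iff, and_assoc])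
      (fun ω => clusterCount_empty_le_card _) (fun ω => clusterCount_empty_le_card _),
    gradedCount_collapse M ∅
      (A' := {ω : BondConfig (Fin 9) | s((0 : Fin 9), 2) ∉ ω ∧ s((1 : Fin 9), 3) ∉ ω} ∩
        {ω | insert s((0 : Fin 9), 2) ω ∈ sepEv (0 : Fin 9) 1})
      (B' := {ω : BondConfig (Fin 9) | s((0 : Fin 9), 2) ∉ ω ∧ s((1 : Fin 9), 3) ∉ ω} ∩
        {ω | insert s((1 : Fin 9), 3) ω ∈ sepEv (0 : Fin 9) 1})
      (κ₁ := fun ω => clusterCount (insert s((0 : Fin 9), 2) ω) ∅) (κ₂ := fun ω => clusterCount (insert s((1 : Fin 9), 3) ω) ∅)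
      (fun i ω => by simp only [mem_inter_iff, mem_setOf_eq, mem_levelSet_iff, and_assoc])
      (fun j ω => by simp only [mem_inter_iff, mem_setOf_eq, mem_levelSet_iff, and_assoc])
      (fun ω => clusterCount_empty_le_card _) (fun ω => clusterCount_empty_le_card _)] at I
  have I' : (294 : ℕ) ≤ 288 := by simpa only [left_eq, right_eq] using I
  omega

/-- **`¬ TwoClusterRayleighGradedNoSqPos`** — the square-free q-graded two-cluster Rayleigh node R_q⁰ (fk-1 g16/g17, p310496) is FALSE:
it fails on `Fin 9`.  refuted-substantive: witness = the 9-vertex, 11-edge graph of the header at level `s = 6` (one above the forest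
slice, which holds there); no cheap repair keeps the graded form (the deficit sits in the interior cells `(2,4), (3,3), (4,2)`); the forest
slice `AdjForestRayleighNoSqPos` and the `(2,2)` cell `CwOsncFibrePos` are untouched by this witness. [cite: Grimmett2006, §3.9 eq. (3.94) (p. 63)]
[cite: Linusson2011, Prop. 2.6] -/
theorem not_twoClusterRayleighGradedNoSqPos : ¬ TwoClusterRayleighGradedNoSqPos := fun h =>
  not_twoClusterRayleighGradedNoSqOn_fin_nine (h 9)

end GradedNoSqCex

end FK

end Summit.CriticalPhenomena.PercolationContinuityZ3.Theorems
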